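/-
Copyright (c) 2026 the pub-hodgecm-mathlib formalisation cell (harness21).  Track B «K2-LIT» prover seat hodgecm-mathlib-K2E4-p14 (g4), 2026-09-04:
‹S› ROAD J, road (d-w) of K2E3-p03 (g3), brick (C2b-ii) «`[Λ¹ : Λ¹(4Λ)] = q^{6m−⌊d∕2⌋}`», FILE A1 — the unit group `Λ^×` of the quaternion ORDER `Λ = 𝒪_E ⊕ 𝒪_E·j` (`j² = ξ`)
of the anisotropic hermitian plane `⟨1, −ξ⟩`, in datum currency: shape algebra, the subgroup and its levels, the transfer letter (the reduced-norm images are in FILE A1b).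
-/
import Literature.NumberTheory.LocalFields.WildQuadraticDatumNormSignConductor   -- ★ datum toolkit (`IsRamifiedQuadraticDatum`, `Valued` API); the sequel FILE A1b uses its deep-norm ∕ dichotomy theorems
import HarnessLib

/-!
# The unit group of the order `Λ = 𝒪_E ⊕ 𝒪_E·j` of the anisotropic plane `⟨1,−ξ⟩` at a wild ramified quadratic datum: levels and reduced-norm images
# (Serre, *Local Fields* V §3; Vignéras, LNM 800, II §1; Riehm 1970)

Cell `pub/hodgecm-mathlib`, Track B «K2-LIT», crux H413 = `stmt-HodgeConjecture-24833` (supports-only, `--as helper`, count-neutral); ‹S› ROAD J, road (d-w) of ‹J3› v2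
(owner K2E3-p03 (g3)); letter (C2) `sig_K2E3WildAnisotropicResidualCount` = (C2-struct) · (C2a) ★ p857092 · (C2b-i) · **(C2b-ii) `[Λ¹ : Λ¹(4Λ)] = q^{6m−⌊d∕2⌋}`** (this seat;
road owner 2026-09-04T03:36:47Z (2), dealer K2E3-plan (g3) 03:38:10Z (R2)).  THEOREMS ONLY (no `def`, no `instance`, no notation, no named fact, no `sorry`).

THE ROAD (census 03:39:19Z, road owner «=» 03:41:14Z): no layer-by-layer lifting.  In the unit group `G = Λ^×` of the order, with `N = 1 + 4Λ ⊴ G` and `f = nrd = det`: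
`[ker f : ker f ∩ N] = [G : N] ∕ [f(G) : f(N)]`.  THIS FILE supplies the group `G`, its levels and the transfer letter; FILE A1b (`K2E3WildOrderUnitGroupNormImage`) the two
images `f(G) = 𝒪_F^×`, `f(N) = U_F^{(2m+⌊d∕2⌋)}`; FILE A2 (`K2E3WildOrderNormOneLevelCount`) counts `[G : N] = (q−1)q^{8m−1}` and assembles; FILE B dresses the result at a CM place.

SETTING (★ datum currency, ONE complete field `K = E` with involution `σ`, `F = K^σ` never a type): `IsRamifiedQuadraticDatum σ ϖ d t` (★ `UnitaryThreeFourFrameDefs`), `[CompleteSpace K]`,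
`[Finite 𝓀[K]]`, `ξ` a `σ`-fixed unit which is NOT a norm `z·σz`.  The ORDER UNIT GROUP is the subgroup `G ≤ GL₂(K)` of the matrices of SHAPE `M(a,c) = [[a, ξ·σc],[c, σa]]`
(Rogawski's `q(a, σc)`, [Rogawski1990, §3.8]) with `a, c ∈ 𝒪_E` and `|det| = |a·σa − ξ·c·σc| = 1` — hypothesis-characterised by the MEMBERSHIP LETTER
`g ∈ G ↔ g₀₁ = ξ·σ g₁₀ ∧ g₁₁ = σ g₀₀ ∧ |g₀₀| ≤ 1 ∧ |g₁₀| ≤ 1 ∧ |det g| = 1` (existence: `exists_subgroup_orderUnits`); its LEVELS `G_k` (`k ≥ 1`) by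
`g ∈ G_k ↔ g ∈ G ∧ |g₀₀ − 1| ≤ exp(−k) ∧ |g₁₀| ≤ exp(−k)` (`exists_subgroup_orderUnits_level`; `G_{4m} = 1 + 4Λ` when `|2| = exp(−2m)`).
* §1 shape algebra: products, the inverse `M(a,c)⁻¹ = D⁻¹·M(σa, −c)` (`D = det`), integrality of all entries, `det = a·σa − ξ·c·σc` is `σ`-fixed.
* §2 `exists_subgroup_orderUnits`, `exists_subgroup_orderUnits_level`, and the TRANSFER LETTER `level_inv_mul_iff` (`g⁻¹g′ ∈ G_k ⟺ |g′₀₀ − g₀₀|, |g′₁₀ − g₁₀| ≤ exp(−k)`: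
  `g′ − g = g·(g⁻¹g′ − 1)` with `g^{±1}` integral) — the only tool the residue counts of FILE A2 need.
* (§2 end) `exists_mem_diag` (the torus `diag(z, σz) ∈ Λ^×`), `det_fixed_of_mem` (`det` is a `σ`-fixed unit on `Λ^×`).
HONEST LABEL: HC_CM is proved only modulo the 7 printed citations (2 remaining named inputs: hLiu418 = `stmt-HodgeConjecture-24832`, h413 = `stmt-HodgeConjecture-24833`) until rung 0
closes; count-neutral local algebra; (C2b-ii)∕(C2)∕(W3) are NOT proved in this file.

## References
* [Serre1979] J.-P. Serre, *Local Fields*, GTM 67 (1979), Ch. V §3 Prop. 5, Cor. 2–3 (norm groups and their filtration in the totally ramified case), Ch. III §3 Prop. 7 (traces).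
* [VignerasLNM800] M.-F. Vignéras, *Arithmétique des algèbres de quaternions*, LNM 800 (1980), Ch. II §1 (orders and reduced norms in a local quaternion algebra).
* [Riehm1970] C. Riehm, *The norm 1 group of a 𝔭-adic division algebra*, Amer. J. Math. 92 (1970), §§1–2 (norm-one filtrations).
* [Rogawski1990] J. D. Rogawski, *Automorphic Representations of Unitary Groups in Three Variables*, Ann. of Math. Stud. 123 (1990), §3.8 p. 33 (`SU(⟨1,−ξ⟩) = D¹`).
-/

set_option autoImplicit false
set_option linter.dupNamespace false

noncomputable section

open WithZero Matrix
open scoped Valued MatrixGroups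

namespace Summit.HodgeConjecture.HodgeConjecture.Cruxes.H413.K2E3WildOrderUnitGroup

/-! ## §1 Shape algebra of the matrices `M(a,c) = [[a, ξ·σc],[c, σa]]` -/

section ShapeAlgebra

variable {K : Type} [Field K] {σ : K →+* K} {ξ : K}

/-- A matrix of SHAPE `[[a, ξσc],[c, σa]]` IS that matrix (eta-expansion). [cite: Rogawski1990, §3.8 p. 33] -/
theorem eq_of_shape {M : Matrix (Fin 2) (Fin 2) K} (h01 : M 0 1 = ξ * σ (M 1 0)) (h11 : M 1 1 = σ (M 0 0)) :
    M = !![M 0 0, ξ * σ (M 1 0); M 1 0, σ (M 0 0)] := by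
  rw [← h01, ← h11]; exact (Matrix.etaExpand_eq M).symm

/-- Determinant of a shape matrix: `det = a·σa − ξ·(c·σc)`. [cite: Rogawski1990, §3.8 p. 33] -/
theorem det_of_shape {M : Matrix (Fin 2) (Fin 2) K} (h01 : M 0 1 = ξ * σ (M 1 0)) (h11 : M 1 1 = σ (M 0 0)) :
    M.det = M 0 0 * σ (M 0 0) - ξ * (M 1 0 * σ (M 1 0)) := by
  rw [Matrix.det_fin_two, h01, h11]; ring

/-- The determinant of a shape matrix is `σ`-fixed (`σσ = 1`, `σξ = ξ`). [cite: Rogawski1990, §3.8 p. 33] -/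
theorem map_det_of_shape (hσ : ∀ x, σ (σ x) = x) (hσξ : σ ξ = ξ) {M : Matrix (Fin 2) (Fin 2) K} (h01 : M 0 1 = ξ * σ (M 1 0)) (h11 : M 1 1 = σ (M 0 0)) :
    σ M.det = M.det := by
  simp only [det_of_shape h01 h11, map_sub, map_mul, hσ, hσξ]; ring

/-- Products of shape matrices have shape: entries `(0,0)`, `(1,0)` of `M·M′` are `aa′ + ξσc·c′`, `ca′ + σa·c′`, and the other two follow. [cite: Rogawski1990, §3.8 p. 33] -/
theorem shape_mul (hσ : ∀ x, σ (σ x) = x) (hσξ : σ ξ = ξ) {M M' : Matrix (Fin 2) (Fin 2) K}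
    (h01 : M 0 1 = ξ * σ (M 1 0)) (h11 : M 1 1 = σ (M 0 0)) (h01' : M' 0 1 = ξ * σ (M' 1 0)) (h11' : M' 1 1 = σ (M' 0 0)) :
    (M * M') 0 1 = ξ * σ ((M * M') 1 0) ∧ (M * M') 1 1 = σ ((M * M') 0 0) := by
  simp only [Matrix.mul_apply, Fin.sum_univ_two, h01, h11, h01', h11', map_add, map_mul, hσ, hσξ]
  constructor <;> ring

/-- The `(0,0)` and `(1,0)` entries of a product of shape matrices. [cite: Rogawski1990, §3.8 p. 33] -/
theorem mul_apply_of_shape {M M' : Matrix (Fin 2) (Fin 2) K} (h01 : M 0 1 = ξ * σ (M 1 0)) (h11 : M 1 1 = σ (M 0 0)) :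
    (M * M') 0 0 = M 0 0 * M' 0 0 + ξ * σ (M 1 0) * M' 1 0 ∧ (M * M') 1 0 = M 1 0 * M' 0 0 + σ (M 0 0) * M' 1 0 := by
  refine ⟨?_, ?_⟩ <;> simp only [Matrix.mul_apply, Fin.sum_univ_two, h01, h11]

end ShapeAlgebra

section ShapeValued

variable {K : Type} [Field K] [Valued K ℤᵐ⁰] {σ : K →+* K} {ξ : K}

/-- All four entries of an INTEGRAL shape matrix are integral (`|ξ| = 1`, `σ` isometric). [cite: VignerasLNM800, Ch. II §1] -/
theorem valued_apply_le_one_of_shape (hvσ : ∀ a, Valued.v (σ a) = Valued.v a) (hξ1 : Valued.v ξ = 1) {M : Matrix (Fin 2) (Fin 2) K}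
    (h01 : M 0 1 = ξ * σ (M 1 0)) (h11 : M 1 1 = σ (M 0 0)) (ha : Valued.v (M 0 0) ≤ 1) (hc : Valued.v (M 1 0) ≤ 1) (i j : Fin 2) :
    Valued.v (M i j) ≤ 1 := by
  fin_cases i <;> fin_cases j
  · exact ha
  · change Valued.v (M 0 1) ≤ 1
    rw [h01, map_mul, hξ1, one_mul, hvσ]; exact hc
  · exact hc
  · change Valued.v (M 1 1) ≤ 1
    rw [h11, hvσ]; exact ha

/-- Ultrametric matrix bound, left: `P` integral, `X` bounded by `r` entrywise ⇒ `P·X` bounded by `r`. [cite: Serre1979, Ch. II §1] -/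
theorem valued_mul_apply_le_left {P X : Matrix (Fin 2) (Fin 2) K} {r : ℤᵐ⁰} (hP : ∀ i j, Valued.v (P i j) ≤ 1) (hX : ∀ i j, Valued.v (X i j) ≤ r) (i j : Fin 2) :
    Valued.v ((P * X) i j) ≤ r := by
  rw [Matrix.mul_apply, Fin.sum_univ_two]
  refine (Valuation.map_add _ _ _).trans (max_le ?_ ?_) <;> rw [map_mul] <;>
    [exact (mul_le_mul' (hP i 0) (hX 0 j)).trans_eq (one_mul r); exact (mul_le_mul' (hP i 1) (hX 1 j)).trans_eq (one_mul r)]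

/-- Ultrametric matrix bound, right: `X` bounded by `r`, `Q` integral ⇒ `X·Q` bounded by `r`. [cite: Serre1979, Ch. II §1] -/
theorem valued_mul_apply_le_right {X Q : Matrix (Fin 2) (Fin 2) K} {r : ℤᵐ⁰} (hX : ∀ i j, Valued.v (X i j) ≤ r) (hQ : ∀ i j, Valued.v (Q i j) ≤ 1) (i j : Fin 2) :
    Valued.v ((X * Q) i j) ≤ r := by
  rw [Matrix.mul_apply, Fin.sum_univ_two]
  refine (Valuation.map_add _ _ _).trans (max_le ?_ ?_) <;> rw [map_mul] <;>
    [exact (mul_le_mul' (hX i 0) (hQ 0 j)).trans_eq (mul_one r); exact (mul_le_mul' (hX i 1) (hQ 1 j)).trans_eq (mul_one r)]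

/-- For a SHAPE matrix `X`, «all four entries of `X − Y` bounded by `r`» is «the `(0,0)` and `(1,0)` entries of `X − Y` bounded by `r`» when `Y` has shape too
(the other two differences are `ξ·σ(·)` and `σ(·)` of these). [cite: VignerasLNM800, Ch. II §1] -/
theorem valued_sub_apply_le_iff_of_shape (hvσ : ∀ a, Valued.v (σ a) = Valued.v a) (hξ1 : Valued.v ξ = 1) {X Y : Matrix (Fin 2) (Fin 2) K} {r : ℤᵐ⁰}
    (hX01 : X 0 1 = ξ * σ (X 1 0)) (hX11 : X 1 1 = σ (X 0 0)) (hY01 : Y 0 1 = ξ * σ (Y 1 0)) (hY11 : Y 1 1 = σ (Y 0 0)) :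
    (∀ i j, Valued.v ((X - Y) i j) ≤ r) ↔ Valued.v (X 0 0 - Y 0 0) ≤ r ∧ Valued.v (X 1 0 - Y 1 0) ≤ r := by
  constructor
  · intro h; exact ⟨h 0 0, h 1 0⟩
  · rintro ⟨ha, hc⟩ i j
    fin_cases i <;> fin_cases j
    · exact ha
    · change Valued.v (X 0 1 - Y 0 1) ≤ r
      rw [hX01, hY01, ← mul_sub, ← map_sub, map_mul, hξ1, one_mul, hvσ]; exact hc
    · exact hc
    · change Valued.v (X 1 1 - Y 1 1) ≤ r
      rw [hX11, hY11, ← map_sub, hvσ]; exact ha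

end ShapeValued

/-! ## §2 The order unit group `G = Λ^×` and its levels `G_k` as subgroups of `GL₂(K)`; the transfer letter -/

section OrderUnits

variable {K : Type} [Field K] [Valued K ℤᵐ⁰] {σ : K →+* K} {ξ : K}

/-- **`Λ^×` IS A SUBGROUP OF `GL₂(K)`**: the invertible matrices of shape `[[a, ξσc],[c, σa]]` with `a, c` integral and `|det| = 1` (`σσ = 1`, `σ` isometric, `σξ = ξ`, `|ξ| = 1`).
Inverse: `M(a,c)⁻¹ = D⁻¹·[[σa, −ξσc],[−c, a]]`, `D = a·σa − ξ·c·σc` fixed of valuation `1`. [cite: VignerasLNM800, Ch. II §1] [cite: Rogawski1990, §3.8 p. 33] -/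
theorem exists_subgroup_orderUnits (hσ : ∀ x, σ (σ x) = x) (hvσ : ∀ a, Valued.v (σ a) = Valued.v a) (hσξ : σ ξ = ξ) (hξ1 : Valued.v ξ = 1) :
    ∃ G : Subgroup (GL (Fin 2) K), ∀ g : GL (Fin 2) K, g ∈ G ↔
      ((g : Matrix (Fin 2) (Fin 2) K) 0 1 = ξ * σ ((g : Matrix (Fin 2) (Fin 2) K) 1 0) ∧ (g : Matrix (Fin 2) (Fin 2) K) 1 1 = σ ((g : Matrix (Fin 2) (Fin 2) K) 0 0) ∧
        Valued.v ((g : Matrix (Fin 2) (Fin 2) K) 0 0) ≤ 1 ∧ Valued.v ((g : Matrix (Fin 2) (Fin 2) K) 1 0) ≤ 1 ∧ Valued.v (g : Matrix (Fin 2) (Fin 2) K).det = 1) := by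
  refine ⟨Subgroup.mk (Submonoid.mk (Subsemigroup.mk (setOf fun g : GL (Fin 2) K =>
      (g : Matrix (Fin 2) (Fin 2) K) 0 1 = ξ * σ ((g : Matrix (Fin 2) (Fin 2) K) 1 0) ∧ (g : Matrix (Fin 2) (Fin 2) K) 1 1 = σ ((g : Matrix (Fin 2) (Fin 2) K) 0 0) ∧
        Valued.v ((g : Matrix (Fin 2) (Fin 2) K) 0 0) ≤ 1 ∧ Valued.v ((g : Matrix (Fin 2) (Fin 2) K) 1 0) ≤ 1 ∧ Valued.v (g : Matrix (Fin 2) (Fin 2) K).det = 1) ?_) ?_) ?_,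
    fun g => Iff.rfl⟩
  · rintro g h ⟨hg01, hg11, hga, hgc, hgd⟩ ⟨hh01, hh11, hha, hhc, hhd⟩
    refine ⟨?_, ?_, ?_, ?_, ?_⟩
    · rw [Units.val_mul]; exact (shape_mul hσ hσξ hg01 hg11 hh01 hh11).1
    · rw [Units.val_mul]; exact (shape_mul hσ hσξ hg01 hg11 hh01 hh11).2
    · rw [Units.val_mul]
      exact valued_mul_apply_le_left (valued_apply_le_one_of_shape hvσ hξ1 hg01 hg11 hga hgc) (valued_apply_le_one_of_shape hvσ hξ1 hh01 hh11 hha hhc) 0 0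
    · rw [Units.val_mul]
      exact valued_mul_apply_le_left (valued_apply_le_one_of_shape hvσ hξ1 hg01 hg11 hga hgc) (valued_apply_le_one_of_shape hvσ hξ1 hh01 hh11 hha hhc) 1 0
    · rw [Units.val_mul, Matrix.det_mul, map_mul, hgd, hhd, mul_one]
  · refine ⟨by simp, by simp, by simp, by simp, by simp⟩
  · rintro g ⟨hg01, hg11, hga, hgc, hgd⟩
    -- the explicit inverse `D⁻¹ • [[σa, −ξσc],[−c, a]]`
    set a := (g : Matrix (Fin 2) (Fin 2) K) 0 0 with ha
    set c := (g : Matrix (Fin 2) (Fin 2) K) 1 0 with hc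
    set D := (g : Matrix (Fin 2) (Fin 2) K).det with hD
    have hDe : D = a * σ a - ξ * (c * σ c) := det_of_shape hg01 hg11
    have hD0 : D ≠ 0 := fun h0 => by rw [h0, map_zero] at hgd; exact zero_ne_one hgd
    have hσD : σ D = D := map_det_of_shape hσ hσξ hg01 hg11
    have hginv : ((g⁻¹ : GL (Fin 2) K) : Matrix (Fin 2) (Fin 2) K) = D⁻¹ • !![σ a, -(ξ * σ c); -c, a] := by
      have hg : (g : Matrix (Fin 2) (Fin 2) K) = !![a, ξ * σ c; c, σ a] := eq_of_shape hg01 hg11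
      have hprod : !![σ a, -(ξ * σ c); -c, a] * !![a, ξ * σ c; c, σ a] = !![D, 0; 0, D] := by
        rw [Matrix.mul_fin_two, hDe]
        ext i j
        fin_cases i <;> fin_cases j <;>
          simp only [Matrix.of_apply, Matrix.cons_val', Matrix.empty_val', Matrix.cons_val_fin_one] <;> ring
      have hleft : (D⁻¹ • !![σ a, -(ξ * σ c); -c, a]) * (g : Matrix (Fin 2) (Fin 2) K) = 1 := by
        rw [hg, Matrix.smul_mul, hprod]
        ext i j
        fin_cases i <;> fin_cases j <;> simp [hD0]
      rw [Matrix.coe_units_inv]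
      exact Matrix.inv_eq_left_inv hleft
    refine ⟨?_, ?_, ?_, ?_, ?_⟩
    · rw [hginv]; simp [Matrix.smul_apply, map_neg, map_mul, map_inv₀, hσD]; ring
    · rw [hginv]; simp [Matrix.smul_apply, map_mul, hσ, map_inv₀, hσD]
    · rw [hginv]; simp only [Matrix.smul_apply, Matrix.of_apply, Matrix.cons_val', Matrix.cons_val_zero, Matrix.cons_val_fin_one, smul_eq_mul, map_mul, map_inv₀, hgd,
        inv_one, one_mul, hvσ]; exact hga
    · rw [hginv]; simp only [Matrix.smul_apply, Matrix.of_apply, Matrix.cons_val', Matrix.cons_val_zero, Matrix.cons_val_one, Matrix.cons_val_fin_one, smul_eq_mul,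
        map_mul, map_inv₀, hgd, inv_one, one_mul, Valuation.map_neg]; exact hgc
    · rw [Matrix.coe_units_inv, Matrix.det_nonsing_inv, Ring.inverse_eq_inv', map_inv₀, hgd, inv_one]


/-- For `g` in the order unit group, `g⁻¹` is in it too and BOTH are integral matrices. [cite: VignerasLNM800, Ch. II §1] -/
theorem valued_coe_apply_le_one (hvσ : ∀ a, Valued.v (σ a) = Valued.v a) (hξ1 : Valued.v ξ = 1) {G : Subgroup (GL (Fin 2) K)}
    (hG : ∀ g : GL (Fin 2) K, g ∈ G ↔
      ((g : Matrix (Fin 2) (Fin 2) K) 0 1 = ξ * σ ((g : Matrix (Fin 2) (Fin 2) K) 1 0) ∧ (g : Matrix (Fin 2) (Fin 2) K) 1 1 = σ ((g : Matrix (Fin 2) (Fin 2) K) 0 0) ∧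
        Valued.v ((g : Matrix (Fin 2) (Fin 2) K) 0 0) ≤ 1 ∧ Valued.v ((g : Matrix (Fin 2) (Fin 2) K) 1 0) ≤ 1 ∧ Valued.v (g : Matrix (Fin 2) (Fin 2) K).det = 1))
    {g : GL (Fin 2) K} (hg : g ∈ G) (i j : Fin 2) : Valued.v ((g : Matrix (Fin 2) (Fin 2) K) i j) ≤ 1 := by
  obtain ⟨h01, h11, ha, hc, -⟩ := (hG g).1 hg
  exact valued_apply_le_one_of_shape hvσ hξ1 h01 h11 ha hc i j

/-- **THE TRANSFER LETTER**: for `g, g′ ∈ Λ^×` and any bound `r`, `g⁻¹g′ ≡ 1` to depth `r` (entries `(0,0)`, `(1,0)`) iff `g′ ≡ g` to depth `r` (entries `(0,0)`, `(1,0)`) — since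
`g′ − g = g·(g⁻¹g′ − 1)` and `g⁻¹g′ − 1 = g⁻¹·(g′ − g)` with `g^{±1}` integral, and the `(0,1)`, `(1,1)` entries of a difference of shape matrices are `ξσ`∕`σ` of the other two.
[cite: VignerasLNM800, Ch. II §1] [cite: Serre1979, Ch. IV §2] -/
theorem level_inv_mul_iff (hvσ : ∀ a, Valued.v (σ a) = Valued.v a) (hξ1 : Valued.v ξ = 1) {G : Subgroup (GL (Fin 2) K)}
    (hG : ∀ g : GL (Fin 2) K, g ∈ G ↔
      ((g : Matrix (Fin 2) (Fin 2) K) 0 1 = ξ * σ ((g : Matrix (Fin 2) (Fin 2) K) 1 0) ∧ (g : Matrix (Fin 2) (Fin 2) K) 1 1 = σ ((g : Matrix (Fin 2) (Fin 2) K) 0 0) ∧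
        Valued.v ((g : Matrix (Fin 2) (Fin 2) K) 0 0) ≤ 1 ∧ Valued.v ((g : Matrix (Fin 2) (Fin 2) K) 1 0) ≤ 1 ∧ Valued.v (g : Matrix (Fin 2) (Fin 2) K).det = 1))
    {g g' : GL (Fin 2) K} (hg : g ∈ G) (hg' : g' ∈ G) (r : ℤᵐ⁰) :
    (Valued.v (((g⁻¹ * g' : GL (Fin 2) K) : Matrix (Fin 2) (Fin 2) K) 0 0 - 1) ≤ r ∧ Valued.v (((g⁻¹ * g' : GL (Fin 2) K) : Matrix (Fin 2) (Fin 2) K) 1 0) ≤ r) ↔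
      (Valued.v ((g' : Matrix (Fin 2) (Fin 2) K) 0 0 - (g : Matrix (Fin 2) (Fin 2) K) 0 0) ≤ r ∧
        Valued.v ((g' : Matrix (Fin 2) (Fin 2) K) 1 0 - (g : Matrix (Fin 2) (Fin 2) K) 1 0) ≤ r) := by
  have hh : g⁻¹ * g' ∈ G := G.mul_mem (G.inv_mem hg) hg'
  obtain ⟨hh01, hh11, -, -, -⟩ := (hG _).1 hh
  obtain ⟨hg01, hg11, -, -, -⟩ := (hG _).1 hg
  obtain ⟨hg'01, hg'11, -, -, -⟩ := (hG _).1 hg'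
  -- shape of `1`
  have h101 : (1 : Matrix (Fin 2) (Fin 2) K) 0 1 = ξ * σ ((1 : Matrix (Fin 2) (Fin 2) K) 1 0) := by simp
  have h111 : (1 : Matrix (Fin 2) (Fin 2) K) 1 1 = σ ((1 : Matrix (Fin 2) (Fin 2) K) 0 0) := by simp
  -- the two matrix identities
  have hprod : (g : Matrix (Fin 2) (Fin 2) K) * (((g⁻¹ * g' : GL (Fin 2) K) : Matrix (Fin 2) (Fin 2) K) - 1) =
      (g' : Matrix (Fin 2) (Fin 2) K) - (g : Matrix (Fin 2) (Fin 2) K) := by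
    rw [Matrix.mul_sub, Matrix.mul_one, Units.val_mul, ← Matrix.mul_assoc, Units.mul_inv, Matrix.one_mul]
  have hprod' : ((g⁻¹ : GL (Fin 2) K) : Matrix (Fin 2) (Fin 2) K) * ((g' : Matrix (Fin 2) (Fin 2) K) - (g : Matrix (Fin 2) (Fin 2) K)) =
      ((g⁻¹ * g' : GL (Fin 2) K) : Matrix (Fin 2) (Fin 2) K) - 1 := by
    rw [Matrix.mul_sub, Units.val_mul, Units.inv_mul]
  rw [show Valued.v (((g⁻¹ * g' : GL (Fin 2) K) : Matrix (Fin 2) (Fin 2) K) 1 0) =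
      Valued.v (((g⁻¹ * g' : GL (Fin 2) K) : Matrix (Fin 2) (Fin 2) K) 1 0 - (1 : Matrix (Fin 2) (Fin 2) K) 1 0) by simp,
    show (1 : K) = (1 : Matrix (Fin 2) (Fin 2) K) 0 0 by simp,
    ← valued_sub_apply_le_iff_of_shape hvσ hξ1 hh01 hh11 h101 h111, ← valued_sub_apply_le_iff_of_shape hvσ hξ1 hg'01 hg'11 hg01 hg11]
  constructor
  · intro h i j
    rw [← hprod]
    exact valued_mul_apply_le_left (valued_coe_apply_le_one hvσ hξ1 hG hg) h i j
  · intro h i j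
    rw [← hprod']
    exact valued_mul_apply_le_left (valued_coe_apply_le_one hvσ hξ1 hG (G.inv_mem hg)) h i j

/-- **THE LEVELS `G_k` (`k ≥ 0`) ARE SUBGROUPS**: `g ∈ G_k ↔ g ∈ G ∧ |g₀₀ − 1| ≤ exp(−k) ∧ |g₁₀| ≤ exp(−k)` (for `|2| = exp(−2m)`, `G_{4m} = Λ^× ∩ (1 + 4Λ)`).  Closure by the transfer letter.
[cite: VignerasLNM800, Ch. II §1] [cite: Serre1979, Ch. IV §2] -/
theorem exists_subgroup_orderUnits_level (hvσ : ∀ a, Valued.v (σ a) = Valued.v a) (hξ1 : Valued.v ξ = 1) {G : Subgroup (GL (Fin 2) K)}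
    (hG : ∀ g : GL (Fin 2) K, g ∈ G ↔
      ((g : Matrix (Fin 2) (Fin 2) K) 0 1 = ξ * σ ((g : Matrix (Fin 2) (Fin 2) K) 1 0) ∧ (g : Matrix (Fin 2) (Fin 2) K) 1 1 = σ ((g : Matrix (Fin 2) (Fin 2) K) 0 0) ∧
        Valued.v ((g : Matrix (Fin 2) (Fin 2) K) 0 0) ≤ 1 ∧ Valued.v ((g : Matrix (Fin 2) (Fin 2) K) 1 0) ≤ 1 ∧ Valued.v (g : Matrix (Fin 2) (Fin 2) K).det = 1))
    (k : ℕ) :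
    ∃ Gk : Subgroup (GL (Fin 2) K), ∀ g : GL (Fin 2) K, g ∈ Gk ↔
      g ∈ G ∧ Valued.v ((g : Matrix (Fin 2) (Fin 2) K) 0 0 - 1) ≤ exp (-(k : ℤ)) ∧ Valued.v ((g : Matrix (Fin 2) (Fin 2) K) 1 0) ≤ exp (-(k : ℤ)) := by
  -- inverse: transfer letter against `g′ = 1`
  have hinv : ∀ g : GL (Fin 2) K, g ∈ G → Valued.v ((g : Matrix (Fin 2) (Fin 2) K) 0 0 - 1) ≤ exp (-(k : ℤ)) →
      Valued.v ((g : Matrix (Fin 2) (Fin 2) K) 1 0) ≤ exp (-(k : ℤ)) →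
      Valued.v (((g⁻¹ : GL (Fin 2) K) : Matrix (Fin 2) (Fin 2) K) 0 0 - 1) ≤ exp (-(k : ℤ)) ∧ Valued.v (((g⁻¹ : GL (Fin 2) K) : Matrix (Fin 2) (Fin 2) K) 1 0) ≤ exp (-(k : ℤ)) := by
    intro g hg ha hc
    have h := (level_inv_mul_iff hvσ hξ1 hG hg G.one_mem (exp (-(k : ℤ)))).2 (by
      refine ⟨?_, ?_⟩
      · rw [Units.val_one, Matrix.one_apply_eq, ← Valuation.map_neg, neg_sub]; exact ha
      · rw [Units.val_one, Matrix.one_apply_ne (by decide), zero_sub, Valuation.map_neg]; exact hc)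
    rwa [mul_one] at h
  refine ⟨Subgroup.mk (Submonoid.mk (Subsemigroup.mk (setOf fun g : GL (Fin 2) K =>
      g ∈ G ∧ Valued.v ((g : Matrix (Fin 2) (Fin 2) K) 0 0 - 1) ≤ exp (-(k : ℤ)) ∧ Valued.v ((g : Matrix (Fin 2) (Fin 2) K) 1 0) ≤ exp (-(k : ℤ))) ?_) ?_) ?_,
    fun g => Iff.rfl⟩
  · rintro g h ⟨hg, hga, hgc⟩ ⟨hh, hha, hhc⟩
    refine ⟨G.mul_mem hg hh, ?_⟩
    -- transfer letter against `(g⁻¹)⁻¹ · h = g · h`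
    obtain ⟨hia, hic⟩ := hinv g hg hga hgc
    have h2 := (level_inv_mul_iff hvσ hξ1 hG (G.inv_mem hg) hh (exp (-(k : ℤ)))).2 ⟨?_, ?_⟩
    · rwa [inv_inv] at h2
    · rw [show (h : Matrix (Fin 2) (Fin 2) K) 0 0 - ((g⁻¹ : GL (Fin 2) K) : Matrix (Fin 2) (Fin 2) K) 0 0 =
          ((h : Matrix (Fin 2) (Fin 2) K) 0 0 - 1) - (((g⁻¹ : GL (Fin 2) K) : Matrix (Fin 2) (Fin 2) K) 0 0 - 1) by ring]
      exact (Valuation.map_sub _ _ _).trans (max_le hha hia)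
    · exact (Valuation.map_sub _ _ _).trans (max_le hhc hic)
  · refine ⟨G.one_mem, ?_, ?_⟩ <;> simp
  · rintro g ⟨hg, hga, hgc⟩
    exact ⟨G.inv_mem hg, hinv g hg hga hgc⟩


/-- The DIAGONAL shape matrix `M(z, 0) = diag(z, σz)` of a unit `z` lies in `Λ^×` with determinant `z·σz`. [cite: Rogawski1990, §3.8 p. 33] -/
theorem exists_mem_diag (hvσ : ∀ a, Valued.v (σ a) = Valued.v a) {G : Subgroup (GL (Fin 2) K)}
    (hG : ∀ g : GL (Fin 2) K, g ∈ G ↔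
      ((g : Matrix (Fin 2) (Fin 2) K) 0 1 = ξ * σ ((g : Matrix (Fin 2) (Fin 2) K) 1 0) ∧ (g : Matrix (Fin 2) (Fin 2) K) 1 1 = σ ((g : Matrix (Fin 2) (Fin 2) K) 0 0) ∧
        Valued.v ((g : Matrix (Fin 2) (Fin 2) K) 0 0) ≤ 1 ∧ Valued.v ((g : Matrix (Fin 2) (Fin 2) K) 1 0) ≤ 1 ∧ Valued.v (g : Matrix (Fin 2) (Fin 2) K).det = 1))
    {z : K} (hz : Valued.v z = 1) :
    ∃ g : GL (Fin 2) K, g ∈ G ∧ (g : Matrix (Fin 2) (Fin 2) K) 0 0 = z ∧ (g : Matrix (Fin 2) (Fin 2) K) 1 0 = 0 ∧ (g : Matrix (Fin 2) (Fin 2) K).det = z * σ z := by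
  have hdet : (!![z, 0; 0, σ z] : Matrix (Fin 2) (Fin 2) K).det = z * σ z := by rw [Matrix.det_fin_two_of]; ring
  have hz0 : z ≠ 0 := fun h => by rw [h, map_zero] at hz; exact zero_ne_one hz
  have hdet0 : (!![z, 0; 0, σ z] : Matrix (Fin 2) (Fin 2) K).det ≠ 0 := by rw [hdet]; exact mul_ne_zero hz0 ((map_ne_zero σ).2 hz0)
  refine ⟨Matrix.GeneralLinearGroup.mkOfDetNeZero _ hdet0, (hG _).2 ⟨?_, ?_, ?_, ?_, ?_⟩, rfl, rfl, hdet⟩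
  · change (!![z, 0; 0, σ z] : Matrix (Fin 2) (Fin 2) K) 0 1 = ξ * σ ((!![z, 0; 0, σ z] : Matrix (Fin 2) (Fin 2) K) 1 0); simp
  · change (!![z, 0; 0, σ z] : Matrix (Fin 2) (Fin 2) K) 1 1 = σ ((!![z, 0; 0, σ z] : Matrix (Fin 2) (Fin 2) K) 0 0); simp
  · change Valued.v ((!![z, 0; 0, σ z] : Matrix (Fin 2) (Fin 2) K) 0 0) ≤ 1; simp [hz]
  · change Valued.v ((!![z, 0; 0, σ z] : Matrix (Fin 2) (Fin 2) K) 1 0) ≤ 1; simp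
  · change Valued.v (!![z, 0; 0, σ z] : Matrix (Fin 2) (Fin 2) K).det = 1; rw [hdet, map_mul, hvσ, hz, mul_one]

/-- For `g ∈ Λ^×` the determinant is a `σ`-FIXED UNIT. [cite: VignerasLNM800, Ch. II §1] -/
theorem det_fixed_of_mem (hσ : ∀ x, σ (σ x) = x) (hσξ : σ ξ = ξ) {G : Subgroup (GL (Fin 2) K)}
    (hG : ∀ g : GL (Fin 2) K, g ∈ G ↔
      ((g : Matrix (Fin 2) (Fin 2) K) 0 1 = ξ * σ ((g : Matrix (Fin 2) (Fin 2) K) 1 0) ∧ (g : Matrix (Fin 2) (Fin 2) K) 1 1 = σ ((g : Matrix (Fin 2) (Fin 2) K) 0 0) ∧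
        Valued.v ((g : Matrix (Fin 2) (Fin 2) K) 0 0) ≤ 1 ∧ Valued.v ((g : Matrix (Fin 2) (Fin 2) K) 1 0) ≤ 1 ∧ Valued.v (g : Matrix (Fin 2) (Fin 2) K).det = 1))
    {g : GL (Fin 2) K} (hg : g ∈ G) : σ (g : Matrix (Fin 2) (Fin 2) K).det = (g : Matrix (Fin 2) (Fin 2) K).det ∧ Valued.v (g : Matrix (Fin 2) (Fin 2) K).det = 1 := by
  obtain ⟨h01, h11, -, -, hd⟩ := (hG g).1 hg
  exact ⟨map_det_of_shape hσ hσξ h01 h11, hd⟩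

end OrderUnits

end Summit.HodgeConjecture.HodgeConjecture.Cruxes.H413.K2E3WildOrderUnitGroup

end
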